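import Literature.NumberTheory.Rogawski1990.ArchCentralValueTransferRay   -- ★ p834860: the ray theorem (part 1) and its rescaling helpers
import HarnessLib

/-!
# The (S-d) RAY THEOREM, PART 2: the central-value predicate is invariant under the SIMULTANEOUS rescaling `(ν′, ν) ↦ (c•ν′, c•ν)` — with part 1
# (★ `ArchCentralValueTransfer.measure_eq`) the locus of (S-d) among Haar pairs is empty or exactly ONE ray
(Rogawski, *Automorphic Representations of Unitary Groups in Three Variables* (1990), §1.7 p. 6 «`dg = c|Ω|` and `dg′ = c|Ω′|` for some constant `c`»,
§14.2 (14.2.1) pp. 232–233, §14.5 p. 239)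

Topic `NumberTheory/Rogawski1990`; namespace `Literature.NumberTheory.Rogawski1990`.  THEOREMS ONLY (no definition, no instance, no named fact, no notation,
no `sorry`).  Cell `pub/hodgecm-mathlib`, ENGINE T1 (crux H413 = `stmt-HodgeConjecture-24833`); author F0P3a-p06 (g8) (T6-L2 pen).  The second half of the
referee's erratum R1-162-O2 on ★ `TransferFactsCanonicalSingular` («invariant only under the SIMULTANEOUS rescaling `(ν′, ν) ↦ (c·ν′, c·ν)`»), kernel-checked.
Books count-neutral; no line edition; nothing here proves (S-d).

THE ARGUMENT.  A thirteen-conjunct system `(m′, m, m_H, t′, t, t_H)` at `(c•ν′, c•ν, ν_H)` pulls back to the system `(c⁻¹•m′, c⁻¹•m, m_H, t′, t, t_H)` at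
`(ν′, ν, ν_H)`: admissibility and the Weil form rescale (★ `IsAdmissibleOn.smul`, ★ `IsQuotientOf.smul_of_eq_nnreal_smul`), (14.2.1) and its ∃-form are
invariant under the COMMON rescaling of `(m′, m)` (★ `IsArchInnerTransfer.smul`, ★ `IsArchInnerTransferExists.smul`) — so the inner-transfer pairs are THE SAME —,
and the endoscopic ∃-form (vi) survives `m′ ↦ c⁻¹•m′` with `a^H ↦ c⁻¹•a^H` (`IsDeltaTransferRel.smul_measure_right` below); hence (S-d) at `(ν′, ν)` read on the
pulled-back system gives (S-d) at `(c•ν′, c•ν)` for every pair.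

* §1 (abstract (4.3.1), then the `arch` dress) `IsDeltaTransferRel.smul_measure_right` ∕ `IsDeltaTransferExistsRel.smul_measure_right` — `f → f^H` for `(m_H, m_G)`
  gives `f → κ.toReal•f^H` for `(m_H, κ•m_G)`; `ArchSmooth₂.smul`; `IsArchDeltaTransferExists.smul_measure_right`.
* §2 **`ArchCentralValueTransfer.nnreal_smul`** — `ArchCentralValueTransfer L H′ T ν′ ν ν_H → ArchCentralValueTransfer L H′ T (c•ν′) (c•ν) ν_H` (`c ≠ 0`, Haar
  right-invariant `ν′ ν`); **`ArchCentralValueTransferExists.nnreal_smul`** — the `∃ν` letter ★ p832777 is invariant under `ν′ ↦ c•ν′` (witness `c•ν`);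
  **`ArchCentralValueTransfer.measure_eq_smul`** — THE CLASSIFICATION: if #77 holds at `(ν′, ν₁)` and (S-d) at `(ν′, ν₁)`, then for every Haar pair `(c•ν′, μ)`,
  (S-d) at `(c•ν′, μ)` iff `μ = c•ν₁` (part 1 ★ `ArchCentralValueTransfer.measure_eq` + this file).
HONEST LABEL: HC_CM is proved only modulo the printed citations until rung 0 closes; this file is unconditional and proves no printed statement.

## References
* [Rogawski1990] J. D. Rogawski, *Automorphic Representations of Unitary Groups in Three Variables*, Ann. of Math. Stud. 123 (1990), §1.7 p. 6, §4.3 (4.3.1) p. 43,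
  §14.2 (14.2.1) pp. 232–233, §14.3 pp. 233–234, §14.5 p. 239.
* [DeitmarEchterhoff2014] A. Deitmar, S. Echterhoff, *Principles of Harmonic Analysis*, 2nd ed. (2014), Thm. 1.5.3.
-/

noncomputable section

open MeasureTheory Measure NumberField NumberField.InfinitePlace IsDedekindDomain Filter Topology
open Literature.MeasureTheory.Group
open scoped ENNReal NNReal Matrix ComplexOrder Classical

namespace Literature.NumberTheory.Rogawski1990

open Literature.NumberTheory.Automorphic Literature.NumberTheory.GaloisRepresentations
open Literature.AlgebraicGeometry.ShimuraVarieties (unitaryGroup hermForm)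

/-! ## §1 (4.3.1) under a rescaling of the `G`-side family, compensated on `f^H` -/

section Abstract

variable {A B : Type*} [Group A] [Group B] [∀ γ : A, MeasurableSpace (A ⧸ Subgroup.centralizer ({γ} : Set A))]
  [∀ γ : B, MeasurableSpace (B ⧸ Subgroup.centralizer ({γ} : Set B))]

/-- **(4.3.1) for `(m_H, κ•m_G)` from (4.3.1) for `(m_H, m_G)`, compensating on `f^H`**: if `f → f^H` for `(m_H, m_G)` and the factor `Δ` then
`f → κ.toReal • f^H` for `(m_H, κ•m_G)` (every `Φ([γ], f)` acquires `κ.toReal`, ★ `classOrbitalIntegral_smul_measure_eq_mul`; `Φ^st_H` is linear in `f^H`,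
★ `stableOrbitalIntegralRel_smul_fun`). [cite: Rogawski1990, §4.3 (4.3.1) p. 43] -/
theorem IsDeltaTransferRel.smul_measure_right {R : A → B → Prop} {stA : A → A → Prop} {regA : A → Prop} {T : TransferFactorData A B R}
    {mH : OrbitalMeasureFamily A} {mG : OrbitalMeasureFamily B} {fH : A → ℂ} {f : B → ℂ}
    (h : IsDeltaTransferRel R stA regA T mH mG fH f) (κ : ℝ≥0∞) :
    IsDeltaTransferRel R stA regA T mH (HSMul.hSMul κ mG) ((κ.toReal : ℂ) • fH) f := by
  intro a ha
  rw [stableOrbitalIntegralRel_smul_fun, h a ha, mul_finsum]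
  exact finsum_congr fun c => by rw [classOrbitalIntegral_smul_measure_eq_mul]; ring

/-- **The ∃-form**: if every `f ∈ Smooth_G` has an `f^H ∈ Smooth_H` for `(m_H, m_G)` and `Smooth_H` is closed under scalars, then every `f` has one for
`(m_H, κ•m_G)`. [cite: Rogawski1990, §4.9 Prop. 4.9.1 (a) p. 55; §14.3 p. 234] -/
theorem IsDeltaTransferExistsRel.smul_measure_right {R : A → B → Prop} {stA : A → A → Prop} {regA : A → Prop} {T : TransferFactorData A B R}
    {mH : OrbitalMeasureFamily A} {mG : OrbitalMeasureFamily B} {SmoothG : (B → ℂ) → Prop} {SmoothH : (A → ℂ) → Prop}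
    (h : IsDeltaTransferExistsRel R stA regA T mH mG SmoothG SmoothH) (hH : ∀ (z : ℂ) (fH : A → ℂ), SmoothH fH → SmoothH (z • fH)) (κ : ℝ≥0∞) :
    IsDeltaTransferExistsRel R stA regA T mH (HSMul.hSMul κ mG) SmoothG SmoothH := fun f hf => by
  obtain ⟨fH, hfH, hT⟩ := h f hf
  exact ⟨_, hH _ fH hfH, hT.smul_measure_right κ⟩

end Abstract

section Arch

variable (L : Type) [Field L] [NumberField L] [IsCMField L]

/-- **`C_c^∞(H_∞)` (★ `ArchSmooth₂`, by restriction along `ι_∞`) is closed under scalars** (★ `IsArchSmooth.smul`).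
[cite: Rogawski1990, §14.3 p. 234] [cite: BorelJacquet1979, §4.1] -/
theorem ArchSmooth₂.smul
    {aH : UnitaryGroup.arch (↥(maximalRealSubfield L)) L (IsCMField.complexConj L) 2
          (Matrix.of fun i j : Fin 2 => if i.val + j.val + 1 = 2 then (1 : L) else 0) ×
        UnitaryGroup.arch (↥(maximalRealSubfield L)) L (IsCMField.complexConj L) 1
          (Matrix.of fun i j : Fin 1 => if i.val + j.val + 1 = 1 then (1 : L) else 0) → ℂ}
    (haH : ArchSmooth₂ L aH) (z : ℂ) : ArchSmooth₂ L (z • aH) := by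
  obtain ⟨φ, hφc, hφs, hφsm, hφa⟩ := haH
  refine ⟨z • φ, hφc.const_smul z, ?_, IsArchSmooth.smul _ z hφsm, fun k => ?_⟩
  · exact hφs.smul_left (f := fun _ => z)
  · simp only [Pi.smul_apply, hφa k]

variable (H' : Matrix (Fin 3) (Fin 3) L)

/-- **The ∃-form of §14.3 at `∞` on smooth test functions survives `m_G ↦ κ•m_G`** (partner `a^H ↦ κ.toReal • a^H`, ★ `ArchSmooth₂.smul`).
[cite: Rogawski1990, §14.3 p. 234; §4.9 Prop. 4.9.1 (a) p. 55] -/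
theorem IsArchDeltaTransferExists.smul_measure_right
    {_ha : ∀ a : (UnitaryGroup.arch (↥(maximalRealSubfield L)) L (IsCMField.complexConj L) 2
          (Matrix.of fun i j : Fin 2 => if i.val + j.val + 1 = 2 then (1 : L) else 0) ×
        UnitaryGroup.arch (↥(maximalRealSubfield L)) L (IsCMField.complexConj L) 1
          (Matrix.of fun i j : Fin 1 => if i.val + j.val + 1 = 1 then (1 : L) else 0)),
      MeasurableSpace ((UnitaryGroup.arch (↥(maximalRealSubfield L)) L (IsCMField.complexConj L) 2
          (Matrix.of fun i j : Fin 2 => if i.val + j.val + 1 = 2 then (1 : L) else 0) ×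
        UnitaryGroup.arch (↥(maximalRealSubfield L)) L (IsCMField.complexConj L) 1
          (Matrix.of fun i j : Fin 1 => if i.val + j.val + 1 = 1 then (1 : L) else 0)) ⧸
        Subgroup.centralizer ({a} : Set (UnitaryGroup.arch (↥(maximalRealSubfield L)) L (IsCMField.complexConj L) 2
          (Matrix.of fun i j : Fin 2 => if i.val + j.val + 1 = 2 then (1 : L) else 0) ×
        UnitaryGroup.arch (↥(maximalRealSubfield L)) L (IsCMField.complexConj L) 1
          (Matrix.of fun i j : Fin 1 => if i.val + j.val + 1 = 1 then (1 : L) else 0))))}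
    {_hγ : ∀ γ : UnitaryGroup.arch (↥(maximalRealSubfield L)) L (IsCMField.complexConj L) 3 H',
      MeasurableSpace (UnitaryGroup.arch (↥(maximalRealSubfield L)) L (IsCMField.complexConj L) 3 H' ⧸
        Subgroup.centralizer ({γ} : Set (UnitaryGroup.arch (↥(maximalRealSubfield L)) L (IsCMField.complexConj L) 3 H')))}
    {T : ArchTransferFactor L H'}
    {mH : OrbitalMeasureFamily (UnitaryGroup.arch (↥(maximalRealSubfield L)) L (IsCMField.complexConj L) 2
          (Matrix.of fun i j : Fin 2 => if i.val + j.val + 1 = 2 then (1 : L) else 0) ×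
        UnitaryGroup.arch (↥(maximalRealSubfield L)) L (IsCMField.complexConj L) 1
          (Matrix.of fun i j : Fin 1 => if i.val + j.val + 1 = 1 then (1 : L) else 0))}
    {mG : OrbitalMeasureFamily (UnitaryGroup.arch (↥(maximalRealSubfield L)) L (IsCMField.complexConj L) 3 H')}
    (h : IsArchDeltaTransferExists L H' T mH mG (ArchSmooth L 3 H') (ArchSmooth₂ L)) (κ : ℝ≥0∞) :
    IsArchDeltaTransferExists L H' T mH (HSMul.hSMul κ mG) (ArchSmooth L 3 H') (ArchSmooth₂ L) :=
  IsDeltaTransferExistsRel.smul_measure_right h (fun z _ hfH => ArchSmooth₂.smul L hfH z) κ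

variable (T : ArchTransferFactor L H')
  [MeasurableSpace (UnitaryGroup.arch (↥(maximalRealSubfield L)) L (IsCMField.complexConj L) 3 H')]
  [BorelSpace (UnitaryGroup.arch (↥(maximalRealSubfield L)) L (IsCMField.complexConj L) 3 H')]
  [MeasurableSpace (UnitaryGroup.arch (↥(maximalRealSubfield L)) L (IsCMField.complexConj L) 3
    (Matrix.of fun i j : Fin 3 => if i.val + j.val + 1 = 3 then (1 : L) else 0))]
  [BorelSpace (UnitaryGroup.arch (↥(maximalRealSubfield L)) L (IsCMField.complexConj L) 3
    (Matrix.of fun i j : Fin 3 => if i.val + j.val + 1 = 3 then (1 : L) else 0))]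
  [MeasurableSpace (UnitaryGroup.arch (↥(maximalRealSubfield L)) L (IsCMField.complexConj L) 2
          (Matrix.of fun i j : Fin 2 => if i.val + j.val + 1 = 2 then (1 : L) else 0) ×
        UnitaryGroup.arch (↥(maximalRealSubfield L)) L (IsCMField.complexConj L) 1
          (Matrix.of fun i j : Fin 1 => if i.val + j.val + 1 = 1 then (1 : L) else 0))]
  [BorelSpace (UnitaryGroup.arch (↥(maximalRealSubfield L)) L (IsCMField.complexConj L) 2
          (Matrix.of fun i j : Fin 2 => if i.val + j.val + 1 = 2 then (1 : L) else 0) ×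
        UnitaryGroup.arch (↥(maximalRealSubfield L)) L (IsCMField.complexConj L) 1
          (Matrix.of fun i j : Fin 1 => if i.val + j.val + 1 = 1 then (1 : L) else 0))]
  (ν' : Measure (UnitaryGroup.arch (↥(maximalRealSubfield L)) L (IsCMField.complexConj L) 3 H'))
  (ν : Measure (UnitaryGroup.arch (↥(maximalRealSubfield L)) L (IsCMField.complexConj L) 3
    (Matrix.of fun i j : Fin 3 => if i.val + j.val + 1 = 3 then (1 : L) else 0)))
  (νH : Measure (UnitaryGroup.arch (↥(maximalRealSubfield L)) L (IsCMField.complexConj L) 2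
          (Matrix.of fun i j : Fin 2 => if i.val + j.val + 1 = 2 then (1 : L) else 0) ×
        UnitaryGroup.arch (↥(maximalRealSubfield L)) L (IsCMField.complexConj L) 1
          (Matrix.of fun i j : Fin 1 => if i.val + j.val + 1 = 1 then (1 : L) else 0)))
  [ν'.IsHaarMeasure] [ν'.IsMulRightInvariant] [ν.IsHaarMeasure] [ν.IsMulRightInvariant]
  [IsFiniteMeasureOnCompacts νH] [νH.IsMulRightInvariant]


/-! ## §2 Simultaneous rescaling -/

/-- **THE (S-d) RAY THEOREM, PART 2 — invariance under the SIMULTANEOUS rescaling `(ν′, ν) ↦ (c•ν′, c•ν)`** (`c ≠ 0`; Haar right-invariant `ν′, ν`): a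
thirteen-conjunct system at `(c•ν′, c•ν, ν_H)` pulls back to one at `(ν′, ν, ν_H)` with THE SAME inner-transfer pairs (common rescaling of `(m′, m)` by `c⁻¹`), so the
central-value identity transfers verbatim.  (Print: only the common constant `c` of `dg = c|Ω|`, `dg′ = c|Ω′|` is free, §1.7 p. 6.)
[cite: Rogawski1990, §1.7 p. 6; §14.2 (14.2.1) pp. 232–233; §14.5 p. 239] [cite: DeitmarEchterhoff2014, Thm. 1.5.3] -/
theorem ArchCentralValueTransfer.nnreal_smul (h : ArchCentralValueTransfer L H' T ν' ν νH) {c : ℝ≥0} (hc : c ≠ 0) :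
    ArchCentralValueTransfer L H' T (c • ν') (c • ν) νH := by
  intro hherm hanis hS₀ iGpm iGpb iGm iGb iHm iHb m' m mH t' t tH hbody a' a ha' ha hrel γ₀ γ ζ hγ₀ hγ
  obtain ⟨hi, hii, hiii, hiv, hv, hvi, hW', hW, hWH, hC', hC, hC'G, hCH⟩ := hbody
  -- the inverse scalar
  have hκ0 : ((c⁻¹ : ℝ≥0) : ℝ≥0∞) ≠ 0 := ENNReal.coe_ne_zero.2 (inv_ne_zero hc)
  have hκtop : ((c⁻¹ : ℝ≥0) : ℝ≥0∞) ≠ ⊤ := ENNReal.coe_ne_top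
  haveI : (c • ν').IsHaarMeasure := IsHaarMeasure.nnreal_smul ν' hc
  haveI : (c • ν).IsHaarMeasure := IsHaarMeasure.nnreal_smul ν hc
  have hν' : ν' = c⁻¹ • (c • ν') := by rw [smul_smul, inv_mul_cancel₀ hc, one_smul]
  have hν : ν = c⁻¹ • (c • ν) := by rw [smul_smul, inv_mul_cancel₀ hc, one_smul]
  -- (S-d) at `(ν′, ν, ν_H)` read on the pulled-back system `(c⁻¹•m′, c⁻¹•m, m_H, t′, t, t_H)` and the SAME pair `(a′, a)`
  exact h hherm hanis hS₀ (HSMul.hSMul ((c⁻¹ : ℝ≥0) : ℝ≥0∞) m') (HSMul.hSMul ((c⁻¹ : ℝ≥0) : ℝ≥0∞) m) mH t' t tH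
    ⟨hi.smul hκ0 hκtop, hii.smul hκ0 hκtop, hiii, hiv, IsArchInnerTransferExists.smul L H' hv _,
      IsArchDeltaTransferExists.smul_measure_right L H' hvi _,
      hW'.smul_of_eq_nnreal_smul (inv_ne_zero hc) hν', hW.smul_of_eq_nnreal_smul (inv_ne_zero hc) hν, hWH, hC', hC, hC'G, hCH⟩
    a' a ha' ha (IsArchInnerTransfer.smul L H' hrel _) γ₀ γ ζ hγ₀ hγ

/-- **The `∃ν` letter ★ `ArchCentralValueTransferExists` is invariant under `ν′ ↦ c•ν′`** (`c ≠ 0`; witness `c•ν`). [cite: Rogawski1990, §1.7 p. 6; §14.5 p. 239] -/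
theorem ArchCentralValueTransferExists.nnreal_smul (h : ArchCentralValueTransferExists L H' T ν' νH) {c : ℝ≥0} (hc : c ≠ 0) :
    ArchCentralValueTransferExists L H' T (c • ν') νH := by
  obtain ⟨μ, hμ, hμr, hSd⟩ := h
  haveI := hμ
  haveI := hμr
  unfold ArchCentralValueTransferExists
  exact ⟨c • μ, IsHaarMeasure.nnreal_smul μ hc, inferInstance, ArchCentralValueTransfer.nnreal_smul L H' T ν' μ νH hSd hc⟩

/-- **THE CLASSIFICATION OF THE (S-d) LOCUS** (parts 1 + 2): if the thirteen-conjunct letter #77 and (S-d) hold at the Haar pair `(ν′, ν₁)`, then at the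
rescaled `c•ν′` (`c ≠ 0`) the central-value identity holds at the Haar measure `μ` IF AND ONLY IF `μ = c•ν₁` — the locus of (S-d) among Haar pairs is exactly
the ray `{(c•ν′, c•ν₁)}` (print's «same constant `c`»).  (#77 itself rescales along the ray: its system pulls back∕pushes forward as in the proof of part 2.)
[cite: Rogawski1990, §1.7 p. 6; §14.5 p. 239] [cite: DeitmarEchterhoff2014, Thm. 1.5.3] -/
theorem ArchCentralValueTransfer.measure_eq_smul (hherm : (H'.map (cmConjRingHom L)).transpose = H')
    (hanis : ∀ x : Fin 3 → L, hermForm (cmConjRingHom L) H' x x = 0 → x = 0)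
    (h77 : ArchTransfersExistCanonical L H' T ν' ν νH) (h₁ : ArchCentralValueTransfer L H' T ν' ν νH) {c : ℝ≥0} (hc : c ≠ 0)
    (μ : Measure (UnitaryGroup.arch (↥(maximalRealSubfield L)) L (IsCMField.complexConj L) 3
      (Matrix.of fun i j : Fin 3 => if i.val + j.val + 1 = 3 then (1 : L) else 0))) [μ.IsHaarMeasure] [μ.IsMulRightInvariant] :
    ArchCentralValueTransfer L H' T (c • ν') μ νH ↔ μ = c • ν := by
  haveI : (c • ν').IsHaarMeasure := IsHaarMeasure.nnreal_smul ν' hc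
  haveI : (c • ν).IsHaarMeasure := IsHaarMeasure.nnreal_smul ν hc
  -- the orbit σ-algebras are Borel (as inside ★ `ArchTransfersExistCanonical`), fixed as local instances
  letI iGpm : ∀ γ' : UnitaryGroup.arch (↥(maximalRealSubfield L)) L (IsCMField.complexConj L) 3 H',
      MeasurableSpace (UnitaryGroup.arch (↥(maximalRealSubfield L)) L (IsCMField.complexConj L) 3 H' ⧸
        Subgroup.centralizer ({γ'} : Set (UnitaryGroup.arch (↥(maximalRealSubfield L)) L (IsCMField.complexConj L) 3 H'))) :=
    fun _ => borel _
  haveI iGpb : ∀ γ' : UnitaryGroup.arch (↥(maximalRealSubfield L)) L (IsCMField.complexConj L) 3 H',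
      BorelSpace (UnitaryGroup.arch (↥(maximalRealSubfield L)) L (IsCMField.complexConj L) 3 H' ⧸
        Subgroup.centralizer ({γ'} : Set (UnitaryGroup.arch (↥(maximalRealSubfield L)) L (IsCMField.complexConj L) 3 H'))) :=
    fun _ => ⟨rfl⟩
  letI iGm : ∀ γ : UnitaryGroup.arch (↥(maximalRealSubfield L)) L (IsCMField.complexConj L) 3
        (Matrix.of fun i j : Fin 3 => if i.val + j.val + 1 = 3 then (1 : L) else 0),
      MeasurableSpace (UnitaryGroup.arch (↥(maximalRealSubfield L)) L (IsCMField.complexConj L) 3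
          (Matrix.of fun i j : Fin 3 => if i.val + j.val + 1 = 3 then (1 : L) else 0) ⧸
        Subgroup.centralizer ({γ} : Set (UnitaryGroup.arch (↥(maximalRealSubfield L)) L (IsCMField.complexConj L) 3
          (Matrix.of fun i j : Fin 3 => if i.val + j.val + 1 = 3 then (1 : L) else 0)))) :=
    fun _ => borel _
  haveI iGb : ∀ γ : UnitaryGroup.arch (↥(maximalRealSubfield L)) L (IsCMField.complexConj L) 3
        (Matrix.of fun i j : Fin 3 => if i.val + j.val + 1 = 3 then (1 : L) else 0),
      BorelSpace (UnitaryGroup.arch (↥(maximalRealSubfield L)) L (IsCMField.complexConj L) 3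
          (Matrix.of fun i j : Fin 3 => if i.val + j.val + 1 = 3 then (1 : L) else 0) ⧸
        Subgroup.centralizer ({γ} : Set (UnitaryGroup.arch (↥(maximalRealSubfield L)) L (IsCMField.complexConj L) 3
          (Matrix.of fun i j : Fin 3 => if i.val + j.val + 1 = 3 then (1 : L) else 0)))) :=
    fun _ => ⟨rfl⟩
  letI iHm : ∀ a : (UnitaryGroup.arch (↥(maximalRealSubfield L)) L (IsCMField.complexConj L) 2
        (Matrix.of fun i j : Fin 2 => if i.val + j.val + 1 = 2 then (1 : L) else 0) ×
      UnitaryGroup.arch (↥(maximalRealSubfield L)) L (IsCMField.complexConj L) 1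
        (Matrix.of fun i j : Fin 1 => if i.val + j.val + 1 = 1 then (1 : L) else 0)),
      MeasurableSpace ((UnitaryGroup.arch (↥(maximalRealSubfield L)) L (IsCMField.complexConj L) 2
          (Matrix.of fun i j : Fin 2 => if i.val + j.val + 1 = 2 then (1 : L) else 0) ×
        UnitaryGroup.arch (↥(maximalRealSubfield L)) L (IsCMField.complexConj L) 1
          (Matrix.of fun i j : Fin 1 => if i.val + j.val + 1 = 1 then (1 : L) else 0)) ⧸
        Subgroup.centralizer ({a} : Set (UnitaryGroup.arch (↥(maximalRealSubfield L)) L (IsCMField.complexConj L) 2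
          (Matrix.of fun i j : Fin 2 => if i.val + j.val + 1 = 2 then (1 : L) else 0) ×
        UnitaryGroup.arch (↥(maximalRealSubfield L)) L (IsCMField.complexConj L) 1
          (Matrix.of fun i j : Fin 1 => if i.val + j.val + 1 = 1 then (1 : L) else 0)))) :=
    fun _ => borel _
  haveI iHb : ∀ a : (UnitaryGroup.arch (↥(maximalRealSubfield L)) L (IsCMField.complexConj L) 2
        (Matrix.of fun i j : Fin 2 => if i.val + j.val + 1 = 2 then (1 : L) else 0) ×
      UnitaryGroup.arch (↥(maximalRealSubfield L)) L (IsCMField.complexConj L) 1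
        (Matrix.of fun i j : Fin 1 => if i.val + j.val + 1 = 1 then (1 : L) else 0)),
      BorelSpace ((UnitaryGroup.arch (↥(maximalRealSubfield L)) L (IsCMField.complexConj L) 2
          (Matrix.of fun i j : Fin 2 => if i.val + j.val + 1 = 2 then (1 : L) else 0) ×
        UnitaryGroup.arch (↥(maximalRealSubfield L)) L (IsCMField.complexConj L) 1
          (Matrix.of fun i j : Fin 1 => if i.val + j.val + 1 = 1 then (1 : L) else 0)) ⧸
        Subgroup.centralizer ({a} : Set (UnitaryGroup.arch (↥(maximalRealSubfield L)) L (IsCMField.complexConj L) 2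
          (Matrix.of fun i j : Fin 2 => if i.val + j.val + 1 = 2 then (1 : L) else 0) ×
        UnitaryGroup.arch (↥(maximalRealSubfield L)) L (IsCMField.complexConj L) 1
          (Matrix.of fun i j : Fin 1 => if i.val + j.val + 1 = 1 then (1 : L) else 0)))) :=
    fun _ => ⟨rfl⟩
  refine ⟨fun h₂ => ?_, fun hμ => ?_⟩
  · -- #77 rescales to `(c•ν′, c•ν)`: push the system forward by `c`
    have h77' : ArchTransfersExistCanonical L H' T (c • ν') (c • ν) νH := by
      intro hherm' hanis'
      obtain ⟨m', m, mH, t', t, tH, hi, hii, hiii, hiv, hv, hvi, hW', hW, hWH, hC', hC, hC'G, hCH⟩ := h77 hherm' hanis'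
      have hκ0 : ((c : ℝ≥0) : ℝ≥0∞) ≠ 0 := ENNReal.coe_ne_zero.2 hc
      have hκtop : ((c : ℝ≥0) : ℝ≥0∞) ≠ ⊤ := ENNReal.coe_ne_top
      exact ⟨HSMul.hSMul ((c : ℝ≥0) : ℝ≥0∞) m', HSMul.hSMul ((c : ℝ≥0) : ℝ≥0∞) m, mH, t', t, tH,
        hi.smul hκ0 hκtop, hii.smul hκ0 hκtop, hiii, hiv, IsArchInnerTransferExists.smul L H' hv _,
        IsArchDeltaTransferExists.smul_measure_right L H' hvi _,
        hW'.smul_of_eq_nnreal_smul hc rfl, hW.smul_of_eq_nnreal_smul hc rfl, hWH, hC', hC, hC'G, hCH⟩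
    exact ArchCentralValueTransfer.measure_eq L H' T (c • ν') (c • ν) μ νH hherm hanis h77'
      (ArchCentralValueTransfer.nnreal_smul L H' T ν' ν νH h₁ hc) h₂
  · subst hμ
    exact ArchCentralValueTransfer.nnreal_smul L H' T ν' ν νH h₁ hc

end Arch

end Literature.NumberTheory.Rogawski1990

end
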